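import Summits.QuantumFields.YangMills.Theses.BalabanFluctuationExport
import HarnessLib

/-!
# Route item `CondResponseGlue` of `BalabanFluctuationExport` (line `response_regime_split` on the crux `UVSeamRec`, stmt-QuantumFields-20043)

Support item stmt-QuantumFields-26655 of the draft export route `BalabanFluctuationExport`:
`RoughFieldResponse → SmallFieldOscillation → SmallFieldsTypical → CondResponse`.  Take the rough half's `δ`, instantiate
oscillation and typicality there; patch the versions `g := g₁` on the measurable δ-small event, `g₂` off it (a version again:
orthogonality splits along `φχ_s + φχ_r`); rough `W`: `RoughFieldResponse`; small `W₀`: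
`μ(s)(g₁W₀ − m) = ∫χ_s∘Q(g₁W₀ − g₁∘Q) + ∫χ_s∘Q(p − m)` and `∫χ_s∘Q(p − m) = −∫χ_r∘Q(p − m) = −∫χ_r∘Q(g₂∘Q − m)` (`∫ p dμ = m`
is the definition of `torusEOn`), so `|g₁W₀ − m| ≤ (C₁ + 2C₂)/b⁴` after dividing by `μ(s) ≥ 1/2`.
`condResponse_of_split_expanded` runs the tactic proof against the `let`-expanded form of `CondResponse` (definitionally the route
decl), `condResponseGlue_proof` is the route item by name (the registered composition `ResponseRegimeSplit.UVSeamRec_of` of the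
crux skeleton uses exactly this glue).

The proof is the ideator's kernel-checked glue (ym-idea-9, `Cruxes/UVSeamRec/Lines/response_regime_split.lean`,
`condResponse_of_splitX`, with the two measurability lemmas inlined), landed under `Theorems/` so that the route item is closed by
name.  Bookkeeping only: none of the three children, nor E0′, NT or the gap is proved; YM mass gap NOT proved.
-/

set_option autoImplicit false

namespace Summit.QuantumFields.YangMills.Cruxes.UVSeamRec.ExportGlue

open MeasureTheory
open Literature.MathematicalPhysics.QuantumFieldTheory
open Literature.MathematicalPhysics.QuantumFieldTheory.Balaban1983to89
open Literature.MathematicalPhysics.QuantumFieldTheory.Balaban1983to89.T4Continuum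
open Literature.MathematicalPhysics.QuantumLattice (LGConfig torusLift fundamentalLatticeRep)
open Summit.QuantumFields.YangMills.Cruxes.OSLegsFromFemtoAndGap.DlrCollarTransfer (plane)
open Summit.QuantumFields.YangMills.Cruxes.UV.TorusClass (torusEOn)
open Summit.QuantumFields.YangMills.Theses.BalabanFluctuationExport

/-- The glue, proved against the `let`-expanded form of the parent `CondResponse` (definitionally equal to the route decl). -/
theorem condResponse_of_split_expanded :
    SmallFieldOscillation → RoughFieldResponse → SmallFieldsTypical →
      letI : MeasurableSpace (Matrix.specialUnitaryGroup (Fin 2) ℂ) := borel _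
      haveI : BorelSpace (Matrix.specialUnitaryGroup (Fin 2) ℂ) := ⟨rfl⟩
      ∀ L : ℕ, Odd L → 11 < L →
      ∃ (C β₄ ℓ₄ : ℝ), 0 < ℓ₄ ∧ 0 ≤ C ∧ ∀ β : ℝ, β₄ ≤ β →
        ∀ (F : T4Family) (K k : ℕ), F.L = L → k + 1 ≤ F.m + K →
          ((L : ℝ) ^ k) * Summit.QuantumFields.YangMills.Cruxes.UVSeamRec.Transport.uRec β ≤ ℓ₄ →
          ∀ (q : Fin 4 × Fin 4) (x : Fin 4 → ℤ), q.1 < q.2 →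
            haveI : NeZero ((F.P K).sitesPerDir 0) := ⟨Params.sitesPerDir_ne_zero _ _⟩
            ∃ g : GaugeField (F.P K) k (Matrix.specialUnitaryGroup (Fin 2) ℂ) → ℝ,
              Measurable (fun V : GaugeConfig 4 ((F.P K).sitesPerDir 0) (Matrix.specialUnitaryGroup (Fin 2) ℂ) =>
                  g (Averaging.iter (fun j => BlockAveraging.blockAvg (P := F.P K) (j := j) su2Mean) k
                    (ofConfig (P := F.P K) (j := 0) V))) ∧
              (∀ W, |g W - torusEOn (Matrix.specialUnitaryGroup (Fin 2) ℂ) (fundamentalLatticeRep 2) β ((F.P K).sitesPerDir 0)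
                  (plane (Matrix.specialUnitaryGroup (Fin 2) ℂ) (fundamentalLatticeRep 2) q x)| ≤ C / ((L : ℝ) ^ k) ^ 4) ∧
              ∀ φ : GaugeField (F.P K) k (Matrix.specialUnitaryGroup (Fin 2) ℂ) → ℝ,
                Measurable (fun V : GaugeConfig 4 ((F.P K).sitesPerDir 0) (Matrix.specialUnitaryGroup (Fin 2) ℂ) =>
                  φ (Averaging.iter (fun j => BlockAveraging.blockAvg (P := F.P K) (j := j) su2Mean) k
                    (ofConfig (P := F.P K) (j := 0) V))) →
                (∀ W, |φ W| ≤ 1) →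
                ∫ V, (plane (Matrix.specialUnitaryGroup (Fin 2) ℂ) (fundamentalLatticeRep 2) q x
                        (torusLift ((F.P K).sitesPerDir 0) V)
                      - g (Averaging.iter (fun j => BlockAveraging.blockAvg (P := F.P K) (j := j) su2Mean) k
                          (ofConfig (P := F.P K) (j := 0) V)))
                    * φ (Averaging.iter (fun j => BlockAveraging.blockAvg (P := F.P K) (j := j) su2Mean) k
                          (ofConfig (P := F.P K) (j := 0) V))
                  ∂(wilsonMeasure (d := 4) (L := (F.P K).sitesPerDir 0) (fundamentalLatticeRep 2).ρ β) = 0 := by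
  classical
  intro hS hR hT
  letI : MeasurableSpace (Matrix.specialUnitaryGroup (Fin 2) ℂ) := borel _
  haveI : BorelSpace (Matrix.specialUnitaryGroup (Fin 2) ℂ) := ⟨rfl⟩
  intro L hLo hL11
  obtain ⟨δ, hδ0, hδ1, C₂, β₂, ℓ₂, hℓ₂, hC₂, hRough⟩ := hR L hLo hL11
  obtain ⟨C₁, β₁, ℓ₁, hℓ₁, hC₁, hSmall⟩ := hS L hLo hL11 δ hδ0 hδ1
  obtain ⟨β₃, ℓ₃, hℓ₃, hTyp⟩ := hT L hLo hL11 δ hδ0 hδ1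
  refine ⟨C₁ + 2 * C₂, max (max β₁ β₂) β₃, min (min ℓ₁ ℓ₂) ℓ₃, lt_min (lt_min hℓ₁ hℓ₂) hℓ₃, by positivity, ?_⟩
  intro β hβ F K k hFL hk hb q x hq
  haveI : NeZero ((F.P K).sitesPerDir 0) := ⟨Params.sitesPerDir_ne_zero _ _⟩
  have hβ₁ : β₁ ≤ β := ((le_max_left _ _).trans (le_max_left _ _)).trans hβ
  have hβ₂ : β₂ ≤ β := ((le_max_right _ _).trans (le_max_left _ _)).trans hβ
  have hβ₃ : β₃ ≤ β := (le_max_right _ _).trans hβ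
  have hb₁ : ((L : ℝ) ^ k) * Summit.QuantumFields.YangMills.Cruxes.UVSeamRec.Transport.uRec β ≤ ℓ₁ :=
    hb.trans ((min_le_left _ _).trans (min_le_left _ _))
  have hb₂ : ((L : ℝ) ^ k) * Summit.QuantumFields.YangMills.Cruxes.UVSeamRec.Transport.uRec β ≤ ℓ₂ :=
    hb.trans ((min_le_left _ _).trans (min_le_right _ _))
  have hb₃ : ((L : ℝ) ^ k) * Summit.QuantumFields.YangMills.Cruxes.UVSeamRec.Transport.uRec β ≤ ℓ₃ := hb.trans (min_le_right _ _)
  set M : ℕ := (F.P K).sitesPerDir 0 with hMdef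
  set Q : GaugeConfig 4 M (Matrix.specialUnitaryGroup (Fin 2) ℂ) →
      GaugeField (F.P K) k (Matrix.specialUnitaryGroup (Fin 2) ℂ) :=
    fun V => Averaging.iter (fun j => BlockAveraging.blockAvg (P := F.P K) (j := j) su2Mean) k
      (ofConfig (P := F.P K) (j := 0) V) with hQdef
  set μ : Measure (GaugeConfig 4 M (Matrix.specialUnitaryGroup (Fin 2) ℂ)) :=
    wilsonMeasure (d := 4) (L := M) (fundamentalLatticeRep 2).ρ β with hμdef
  set pV : GaugeConfig 4 M (Matrix.specialUnitaryGroup (Fin 2) ℂ) → ℝ :=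
    fun V => plane (Matrix.specialUnitaryGroup (Fin 2) ℂ) (fundamentalLatticeRep 2) q x (torusLift M V) with hpVdef
  set m : ℝ := torusEOn (Matrix.specialUnitaryGroup (Fin 2) ℂ) (fundamentalLatticeRep 2) β M
    (plane (Matrix.specialUnitaryGroup (Fin 2) ℂ) (fundamentalLatticeRep 2) q x) with hmdef
  let c : Site (F.P K) k :=
    fun ν => (((((x ν : ℤ) : ZMod ((F.P K).sitesPerDir 0))).val / F.L ^ k : ℕ) : ZMod ((F.P K).sitesPerDir k))
  let Sm : GaugeField (F.P K) k (Matrix.specialUnitaryGroup (Fin 2) ℂ) → Prop :=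
    fun W => PlaqSmallOn {pl : Plaq (F.P K) k | Site.tdist pl.src c ≤ 2} δ W
  -- the three inputs at this family member
  obtain ⟨g₁, hg₁m, ⟨D₁, hD₁⟩, hg₁osc, hg₁o⟩ := hSmall β hβ₁ F K k hFL hk hb₁ q x hq
  obtain ⟨g₂, hg₂m, ⟨D₂, hD₂⟩, hg₂b, hg₂o⟩ := hRough β hβ₂ F K k hFL hk hb₂ q x hq
  have htyp : (1 / 2 : ℝ) ≤ (μ {V | Sm (Q V)}).toReal := hTyp β hβ₃ F K k hFL hk hb₃ x
  -- measurability of the event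
  have hQm : Measurable Q := by
    have hav : ∀ j, Measurable (fun U : GaugeField (F.P K) j (Matrix.specialUnitaryGroup (Fin 2) ℂ) =>
        (BlockAveraging.blockAvg (P := F.P K) (j := j) su2Mean).avg U) :=
      fun j => BlockAveraging.measurable_avgFun (P := F.P K) (j := j) su2Mean measurable_su2Mean_E
    have hiter : ∀ k', Measurable (Averaging.iter (P := F.P K) (G := Matrix.specialUnitaryGroup (Fin 2) ℂ)
        (fun j => BlockAveraging.blockAvg (P := F.P K) (j := j) su2Mean) k') := by
      intro k'
      induction k' with
      | zero => exact measurable_id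
      | succ k' ih => exact (hav k').comp ih
    have hof : Measurable (fun V : GaugeConfig 4 M (Matrix.specialUnitaryGroup (Fin 2) ℂ) =>
        ofConfig (P := F.P K) (j := 0) V) :=
      measurable_pi_lambda _ fun b => measurable_pi_apply _
    exact (hiter k).comp hof
  have hSm : MeasurableSet {V : GaugeConfig 4 M (Matrix.specialUnitaryGroup (Fin 2) ℂ) | Sm (Q V)} := by
    have hpl : ∀ pl : Plaq (F.P K) k, Measurable (fun W : GaugeField (F.P K) k (Matrix.specialUnitaryGroup (Fin 2) ℂ) =>
        dist1 (GaugeField.plaqHol W pl)) := fun pl => by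
      have hb : ∀ b : PBond (F.P K) k,
          Continuous fun U : (PBond (F.P K) k → Matrix.specialUnitaryGroup (Fin 2) ℂ) => U b :=
        fun b => continuous_apply b
      have hc : Continuous fun U : (PBond (F.P K) k → Matrix.specialUnitaryGroup (Fin 2) ℂ) =>
          GaugeField.plaqHol (P := F.P K) (j := k) U pl := by
        unfold GaugeField.plaqHol
        exact (((hb _).mul (hb _)).mul (hb _).inv).mul (hb _).inv
      exact RegularGaugeGroup.measurable_dist1.comp hc.measurable
    have hS : MeasurableSet {W : GaugeField (F.P K) k (Matrix.specialUnitaryGroup (Fin 2) ℂ) | Sm W} := by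
      have : {W : GaugeField (F.P K) k (Matrix.specialUnitaryGroup (Fin 2) ℂ) | Sm W}
          = ⋂ pl ∈ {pl : Plaq (F.P K) k | Site.tdist pl.src c ≤ 2}, {W | dist1 (GaugeField.plaqHol W pl) < δ} := by
        ext W; simp only [Sm, PlaqSmallOn, Set.mem_setOf_eq, Set.mem_iInter]
      rw [this]
      exact MeasurableSet.biInter (Set.to_countable _) fun pl _ => measurableSet_lt (hpl pl) measurable_const
    exact hQm hS
  -- probability measure, bounded plane observable
  haveI : IsProbabilityMeasure μ :=
    isProbabilityMeasure_wilsonMeasure (d := 4) (L := M) (fundamentalLatticeRep 2).ρ (fundamentalLatticeRep 2).continuous β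
  obtain ⟨B, hB⟩ := Summit.QuantumFields.YangMills.Cruxes.OSLegsFromFemtoAndGap.DlrCollarTransfer.exists_abs_plane_le
    (G := Matrix.specialUnitaryGroup (Fin 2) ℂ) (fundamentalLatticeRep 2)
  have hpVm : Measurable pV :=
    (Summit.QuantumFields.YangMills.Cruxes.OSLegsFromFemtoAndGap.DlrCollarTransfer.continuous_plane
      (G := Matrix.specialUnitaryGroup (Fin 2) ℂ) (fundamentalLatticeRep 2) q x).measurable.comp
      (measurable_torusLift (d := 4) (G := Matrix.specialUnitaryGroup (Fin 2) ℂ) M)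
  have hpVb : ∀ V, |pV V| ≤ B := fun V => hB q x _
  -- generic integrability of bounded measurable functions on the probability space
  have hint : ∀ (f : GaugeConfig 4 M (Matrix.specialUnitaryGroup (Fin 2) ℂ) → ℝ) (A : ℝ),
      Measurable f → (∀ V, |f V| ≤ A) → Integrable f μ := fun f A hfm hfb =>
    Integrable.mono' (integrable_const A) hfm.aestronglyMeasurable
      (Filter.Eventually.of_forall fun V => by rw [Real.norm_eq_abs]; exact hfb V)
  -- indicator test functions of the two regimes
  let χs : GaugeField (F.P K) k (Matrix.specialUnitaryGroup (Fin 2) ℂ) → ℝ := fun W => if Sm W then 1 else 0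
  let χr : GaugeField (F.P K) k (Matrix.specialUnitaryGroup (Fin 2) ℂ) → ℝ := fun W => if Sm W then 0 else 1
  have hχsm : Measurable (fun V => χs (Q V)) := Measurable.ite hSm measurable_const measurable_const
  have hχrm : Measurable (fun V => χr (Q V)) := Measurable.ite hSm measurable_const measurable_const
  have hχsb : ∀ W, |χs W| ≤ 1 := fun W => by by_cases h : Sm W <;> simp [χs, h]
  have hχrb : ∀ W, |χr W| ≤ 1 := fun W => by by_cases h : Sm W <;> simp [χr, h]
  have hχs01 : ∀ W, 0 ≤ χs W ∧ χs W ≤ 1 := fun W => by by_cases h : Sm W <;> simp [χs, h]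
  have hχr01 : ∀ W, 0 ≤ χr W ∧ χr W ≤ 1 := fun W => by by_cases h : Sm W <;> simp [χr, h]
  -- integrability of the regime-weighted centred observables
  have hPs_int : Integrable (fun V => χs (Q V) * (pV V - m)) μ :=
    hint (fun V => χs (Q V) * (pV V - m)) (1 * (B + |m|)) (hχsm.mul (hpVm.sub measurable_const)) fun V => by
      rw [abs_mul]; exact mul_le_mul (hχsb _) ((abs_sub _ _).trans (add_le_add (hpVb _) le_rfl)) (abs_nonneg _) zero_le_one
  have hPr_int : Integrable (fun V => χr (Q V) * (pV V - m)) μ :=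
    hint (fun V => χr (Q V) * (pV V - m)) (1 * (B + |m|)) (hχrm.mul (hpVm.sub measurable_const)) fun V => by
      rw [abs_mul]; exact mul_le_mul (hχrb _) ((abs_sub _ _).trans (add_le_add (hpVb _) le_rfl)) (abs_nonneg _) zero_le_one
  have hBr_int : Integrable (fun V => χr (Q V) * (g₂ (Q V) - m)) μ :=
    hint (fun V => χr (Q V) * (g₂ (Q V) - m)) (1 * (D₂ + |m|)) (hχrm.mul (hg₂m.sub measurable_const)) fun V => by
      rw [abs_mul]; exact mul_le_mul (hχrb _) ((abs_sub _ _).trans (add_le_add (hD₂ _) le_rfl)) (abs_nonneg _) zero_le_one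
  -- ∫ χs∘Q = μ(s).toReal ≥ 1/2
  have hχs_int : ∫ V, χs (Q V) ∂μ = (μ {V | Sm (Q V)}).toReal := by
    have : (fun V => χs (Q V)) = Set.indicator {V | Sm (Q V)} (fun _ => (1 : ℝ)) := by
      funext V; by_cases h : Sm (Q V) <;> simp [χs, h, Set.indicator]
    rw [this, integral_indicator_const (1 : ℝ) hSm]
    simp [Measure.real]
  have hμs : (1 / 2 : ℝ) ≤ ∫ V, χs (Q V) ∂μ := hχs_int ▸ htyp
  -- the mean identity ∫ p dμ = m (definition of `torusEOn`) and ∫ (p − m) = 0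
  have hmean : ∫ V, pV V ∂μ = m := by simp [hpVdef, hmdef, torusEOn, hμdef]
  have hcent : ∫ V, (pV V - m) ∂μ = 0 := by
    rw [integral_sub (hint pV B hpVm hpVb) (integrable_const m), hmean]
    simp
  -- the patched version
  let g : GaugeField (F.P K) k (Matrix.specialUnitaryGroup (Fin 2) ℂ) → ℝ := fun W => if Sm W then g₁ W else g₂ W
  have hgm : Measurable (fun V => g (Q V)) := Measurable.ite hSm hg₁m hg₂m
  have hLpos : (0 : ℝ) < ((L : ℝ) ^ k) ^ 4 := by positivity
  -- KEY ESTIMATE on a small block field W₀: |g₁ W₀ − m| ≤ (C₁ + 2 C₂)/b⁴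
  have hsmall : ∀ W₀, Sm W₀ → |g₁ W₀ - m| ≤ (C₁ + 2 * C₂) / ((L : ℝ) ^ k) ^ 4 := by
    intro W₀ hW₀
    -- A := ∫ χs∘Q · (g₁ W₀ − g₁∘Q),  B := ∫ χs∘Q · (g₁∘Q − m)
    have hA_int : Integrable (fun V => χs (Q V) * (g₁ W₀ - g₁ (Q V))) μ :=
      hint _ (1 * (|g₁ W₀| + D₁)) (hχsm.mul (measurable_const.sub hg₁m)) fun V => by
        rw [abs_mul]; exact mul_le_mul (hχsb _) ((abs_sub _ _).trans (add_le_add le_rfl (hD₁ _))) (abs_nonneg _) zero_le_one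
    have hB_int : Integrable (fun V => χs (Q V) * (g₁ (Q V) - m)) μ :=
      hint _ (1 * (D₁ + |m|)) (hχsm.mul (hg₁m.sub measurable_const)) fun V => by
        rw [abs_mul]; exact mul_le_mul (hχsb _) ((abs_sub _ _).trans (add_le_add (hD₁ _) le_rfl)) (abs_nonneg _) zero_le_one
    have hsum : (g₁ W₀ - m) * ∫ V, χs (Q V) ∂μ
        = (∫ V, χs (Q V) * (g₁ W₀ - g₁ (Q V)) ∂μ) + ∫ V, χs (Q V) * (g₁ (Q V) - m) ∂μ := by
      rw [← integral_add hA_int hB_int, ← integral_const_mul]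
      refine integral_congr_ae (Filter.Eventually.of_forall fun V => ?_)
      simp only; ring
    -- |A| ≤ (C₁/b⁴) ∫ χs∘Q
    have hA : |∫ V, χs (Q V) * (g₁ W₀ - g₁ (Q V)) ∂μ| ≤ (C₁ / ((L : ℝ) ^ k) ^ 4) * ∫ V, χs (Q V) ∂μ := by
      rw [← integral_const_mul]
      refine (abs_integral_le_integral_abs).trans (integral_mono (hA_int.abs) ((hint (fun V => χs (Q V)) 1 hχsm fun V => hχsb _).const_mul _) fun V => ?_)
      simp only
      by_cases h : Sm (Q V)
      · rw [abs_mul]; simp only [χs, if_pos h, abs_one, one_mul, mul_one]; exact hg₁osc W₀ (Q V) hW₀ h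
      · simp [χs, h]
    -- B = ∫ χs∘Q (p − m) = −∫ χr∘Q (p − m) = −∫ χr∘Q (g₂∘Q − m)
    have hB1 : ∫ V, χs (Q V) * (g₁ (Q V) - m) ∂μ = ∫ V, χs (Q V) * (pV V - m) ∂μ := by
      have h0 : ∫ V, (pV V - g₁ (Q V)) * χs (Q V) ∂μ = 0 := hg₁o χs hχsm hχsb
      have h1 : ∫ V, χs (Q V) * (pV V - m) ∂μ - ∫ V, χs (Q V) * (g₁ (Q V) - m) ∂μ = 0 := by
        rw [← integral_sub hPs_int hB_int, ← h0]
        refine integral_congr_ae (Filter.Eventually.of_forall fun V => ?_); simp only; ring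
      linarith
    have hB2 : ∫ V, χs (Q V) * (pV V - m) ∂μ = - ∫ V, χr (Q V) * (pV V - m) ∂μ := by
      have hsplit : ∫ V, χs (Q V) * (pV V - m) ∂μ + ∫ V, χr (Q V) * (pV V - m) ∂μ = ∫ V, (pV V - m) ∂μ := by
        rw [← integral_add hPs_int hPr_int]
        refine integral_congr_ae (Filter.Eventually.of_forall fun V => ?_)
        by_cases h : Sm (Q V) <;> simp [χs, χr, h]
      linarith [hcent]
    have hB3 : ∫ V, χr (Q V) * (pV V - m) ∂μ = ∫ V, χr (Q V) * (g₂ (Q V) - m) ∂μ := by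
      have h0 : ∫ V, (pV V - g₂ (Q V)) * χr (Q V) ∂μ = 0 := hg₂o χr hχrm hχrb
      have h1 : ∫ V, χr (Q V) * (pV V - m) ∂μ - ∫ V, χr (Q V) * (g₂ (Q V) - m) ∂μ = 0 := by
        rw [← integral_sub hPr_int hBr_int, ← h0]
        refine integral_congr_ae (Filter.Eventually.of_forall fun V => ?_); simp only; ring
      linarith
    have hB : |∫ V, χs (Q V) * (g₁ (Q V) - m) ∂μ| ≤ C₂ / ((L : ℝ) ^ k) ^ 4 := by
      rw [hB1, hB2, hB3, abs_neg]
      calc |∫ V, χr (Q V) * (g₂ (Q V) - m) ∂μ|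
          ≤ ∫ V, |χr (Q V) * (g₂ (Q V) - m)| ∂μ := abs_integral_le_integral_abs
        _ ≤ ∫ V, (C₂ / ((L : ℝ) ^ k) ^ 4) ∂μ := by
            refine integral_mono hBr_int.abs (integrable_const _) fun V => ?_
            simp only
            by_cases h : Sm (Q V)
            · simp only [χr, if_pos h, zero_mul, abs_zero]; exact div_nonneg hC₂ hLpos.le
            · rw [abs_mul]; simp only [χr, if_neg h, abs_one, one_mul]; exact hg₂b (Q V) h
        _ = C₂ / ((L : ℝ) ^ k) ^ 4 := by simp
    -- combine: |g₁ W₀ − m| · ∫χs ≤ (C₁/b⁴) ∫χs + C₂/b⁴, and ∫χs ≥ 1/2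
    have hI0 : (1 / 2 : ℝ) ≤ ∫ V, χs (Q V) ∂μ := hμs
    have hkey : |g₁ W₀ - m| * ∫ V, χs (Q V) ∂μ ≤ (C₁ / ((L : ℝ) ^ k) ^ 4) * ∫ V, χs (Q V) ∂μ + C₂ / ((L : ℝ) ^ k) ^ 4 := by
      have : |(g₁ W₀ - m) * ∫ V, χs (Q V) ∂μ| ≤ _ := (congrArg abs hsum).le.trans ((abs_add_le _ _).trans (add_le_add hA hB))
      rwa [abs_mul, abs_of_nonneg (le_trans (by norm_num) hI0)] at this
    have hC₁' : 0 ≤ C₁ / ((L : ℝ) ^ k) ^ 4 := div_nonneg hC₁ hLpos.le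
    have hC₂' : 0 ≤ C₂ / ((L : ℝ) ^ k) ^ 4 := div_nonneg hC₂ hLpos.le
    rw [add_div, mul_div_assoc]
    nlinarith [abs_nonneg (g₁ W₀ - m), hI0, hkey, hC₁', hC₂']
  refine ⟨g, hgm, ?_, ?_⟩
  · -- the bound everywhere
    intro W
    by_cases h : Sm W
    · simp only [g, if_pos h]; exact hsmall W h
    · simp only [g, if_neg h]
      refine (hg₂b W h).trans (div_le_div_of_nonneg_right ?_ hLpos.le)
      linarith
  · -- orthogonality of the patched version
    intro φ hφm hφb
    let φs : GaugeField (F.P K) k (Matrix.specialUnitaryGroup (Fin 2) ℂ) → ℝ := fun W => if Sm W then φ W else 0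
    let φr : GaugeField (F.P K) k (Matrix.specialUnitaryGroup (Fin 2) ℂ) → ℝ := fun W => if Sm W then 0 else φ W
    have hφsm : Measurable (fun V => φs (Q V)) := Measurable.ite hSm hφm measurable_const
    have hφrm : Measurable (fun V => φr (Q V)) := Measurable.ite hSm measurable_const hφm
    have hφsb : ∀ W, |φs W| ≤ 1 := fun W => by by_cases h : Sm W <;> simp [φs, h, hφb W]
    have hφrb : ∀ W, |φr W| ≤ 1 := fun W => by by_cases h : Sm W <;> simp [φr, h, hφb W]
    have h1 : ∫ V, (pV V - g₁ (Q V)) * φs (Q V) ∂μ = 0 := hg₁o φs hφsm hφsb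
    have h2 : ∫ V, (pV V - g₂ (Q V)) * φr (Q V) ∂μ = 0 := hg₂o φr hφrm hφrb
    have hint2 : ∀ (gg : GaugeField (F.P K) k (Matrix.specialUnitaryGroup (Fin 2) ℂ) → ℝ) (D : ℝ), (∀ W, |gg W| ≤ D) →
        Measurable (fun V => gg (Q V)) → ∀ χ : GaugeField (F.P K) k (Matrix.specialUnitaryGroup (Fin 2) ℂ) → ℝ,
        Measurable (fun V => χ (Q V)) → (∀ W, |χ W| ≤ 1) →
        Integrable (fun V => (pV V - gg (Q V)) * χ (Q V)) μ := fun gg D hD hggm χ hχm hχb =>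
      hint _ ((B + D) * 1) ((hpVm.sub hggm).mul hχm) fun V => by
        rw [abs_mul]
        have h1 : |pV V - gg (Q V)| ≤ B + D := (abs_sub _ _).trans (add_le_add (hpVb _) (hD _))
        exact mul_le_mul h1 (hχb _) (abs_nonneg _) ((abs_nonneg _).trans h1)
    have hsplit : ∀ V, (pV V - g (Q V)) * φ (Q V) = (pV V - g₁ (Q V)) * φs (Q V) + (pV V - g₂ (Q V)) * φr (Q V) := fun V => by
      by_cases h : Sm (Q V) <;> simp [g, φs, φr, h]
    show ∫ V, (pV V - g (Q V)) * φ (Q V) ∂μ = 0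
    calc ∫ V, (pV V - g (Q V)) * φ (Q V) ∂μ
        = ∫ V, ((pV V - g₁ (Q V)) * φs (Q V) + (pV V - g₂ (Q V)) * φr (Q V)) ∂μ :=
          integral_congr_ae (Filter.Eventually.of_forall hsplit)
      _ = ∫ V, (pV V - g₁ (Q V)) * φs (Q V) ∂μ + ∫ V, (pV V - g₂ (Q V)) * φr (Q V) ∂μ :=
          integral_add (hint2 g₁ D₁ hD₁ hg₁m φs hφsm hφsb) (hint2 g₂ D₂ hD₂ hg₂m φr hφrm hφrb)
      _ = 0 := by rw [h1, h2, add_zero]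

/-- **Route item `CondResponseGlue` (stmt-QuantumFields-26655)**:
`RoughFieldResponse → SmallFieldOscillation → SmallFieldsTypical → CondResponse` (the previous theorem in the gate's order,
read on the route decl by `let`-expansion). -/
theorem condResponseGlue_proof : CondResponseGlue :=
  fun hR hS hT => condResponse_of_split_expanded hS hR hT

end Summit.QuantumFields.YangMills.Cruxes.UVSeamRec.ExportGlue
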